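import Summits.Ventures.PercRepro.Induction
import Summits.Ventures.PercRepro.C005

/-!
# C-005: the edge-reveal identity and the reduction to the cross term `M ≥ 0`

`conjectures/C-005.md` §Induction: revealing one edge `e` (weight `t = p e`) of the defect
`D = top · bot - (x₁x₂ + x₁x₃ + x₂x₃)` gives `D(p) = t² D(p[e:=1]) + (1-t)² D(p[e:=0]) + t(1-t) M`
with the polarised cross term `M = T¹B⁰ + T⁰B¹ - ∑_{i<j}(xᵢ¹xⱼ⁰ + xᵢ⁰xⱼ¹)`
(`crossTerm`, `c005Defect_split`). At deterministic weights `D = 0` (`c005Defect_detWeights`), so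
by typer-1's `induction_free` C-005 follows from `M ≥ 0` for every graph, edge and weight vector
(`CrossTermNonneg`, a named Prop verified on 37,223 census instances — the open T2 problem):
`C005conn_of_crossTermNonneg`.
-/

namespace PercRepro

open Finset

variable {V E : Type*}

namespace MultiGraph

variable [Fintype E] [DecidableEq E] (G : MultiGraph V E)

/-! ### The cross term and the edge induction -/

/-- The defect of C-005: `D = top · bot - (x₁x₂ + x₁x₃ + x₂x₃)`. -/
noncomputable def c005Defect (p : E → ℝ) (a b c d : V) : ℝ :=
  prob p (G.topEvent a b c d) * prob p (G.botEvent a b c d) -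
    (prob p (G.crossEvent₁ a b c d) * prob p (G.crossEvent₂ a b c d) +
      prob p (G.crossEvent₁ a b c d) * prob p (G.crossEvent₃ a b c d) +
      prob p (G.crossEvent₂ a b c d) * prob p (G.crossEvent₃ a b c d))

/-- The polarised cross term `M` of `C-005.md` §Induction for the edge `e`:
`M = T¹B⁰ + T⁰B¹ - ∑_{i<j} (xᵢ¹xⱼ⁰ + xᵢ⁰xⱼ¹)`, where `(·)¹ = P_{p[e:=1]}` and `(·)⁰ = P_{p[e:=0]}`
(the conditionals on `e` open / closed). -/
noncomputable def crossTerm (p : E → ℝ) (e : E) (a b c d : V) : ℝ :=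
  prob (Function.update p e 1) (G.topEvent a b c d) *
      prob (Function.update p e 0) (G.botEvent a b c d) +
    prob (Function.update p e 0) (G.topEvent a b c d) *
      prob (Function.update p e 1) (G.botEvent a b c d) -
    (prob (Function.update p e 1) (G.crossEvent₁ a b c d) *
        prob (Function.update p e 0) (G.crossEvent₂ a b c d) +
      prob (Function.update p e 0) (G.crossEvent₁ a b c d) *
        prob (Function.update p e 1) (G.crossEvent₂ a b c d) +
      prob (Function.update p e 1) (G.crossEvent₁ a b c d) *
        prob (Function.update p e 0) (G.crossEvent₃ a b c d) +
      prob (Function.update p e 0) (G.crossEvent₁ a b c d) *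
        prob (Function.update p e 1) (G.crossEvent₃ a b c d) +
      prob (Function.update p e 1) (G.crossEvent₂ a b c d) *
        prob (Function.update p e 0) (G.crossEvent₃ a b c d) +
      prob (Function.update p e 0) (G.crossEvent₂ a b c d) *
        prob (Function.update p e 1) (G.crossEvent₃ a b c d))

/-- **Edge-reveal identity**: `D(p) = t² D(p[e:=1]) + (1-t)² D(p[e:=0]) + t(1-t) M(p, e)`,
`t = p e`. -/
theorem c005Defect_split (p : E → ℝ) (e : E) (a b c d : V) :
    G.c005Defect p a b c d =
      p e ^ 2 * G.c005Defect (Function.update p e 1) a b c d +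
        (1 - p e) ^ 2 * G.c005Defect (Function.update p e 0) a b c d +
        p e * (1 - p e) * G.crossTerm p e a b c d := by
  unfold c005Defect crossTerm
  rw [prob_split p e (G.topEvent a b c d), prob_split p e (G.botEvent a b c d),
    prob_split p e (G.crossEvent₁ a b c d), prob_split p e (G.crossEvent₂ a b c d),
    prob_split p e (G.crossEvent₃ a b c d)]
  ring

/-- At deterministic weights the five cells are disjoint point events and `D = 0`. -/
theorem c005Defect_detWeights (σ : Config E) (a b c d : V) :
    G.c005Defect (detWeights σ) a b c d = 0 := by
  have hd : ∀ {A B : Set (Config E)}, (σ ∈ A → σ ∈ B → False) →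
      prob (detWeights σ) A * prob (detWeights σ) B = 0 := by
    intro A B hAB
    rw [prob_detWeights, prob_detWeights]
    by_cases hA : σ ∈ A
    · rw [Set.indicator_of_notMem (fun hB => hAB hA hB), mul_zero]
    · rw [Set.indicator_of_notMem hA, zero_mul]
  unfold c005Defect
  rw [hd, hd, hd, hd]
  · ring
  · intro h1 h2
    rw [mem_crossEvent₂] at h1
    rw [mem_crossEvent₃] at h2
    exact h1.2.2 ((h1.1).trans (h2.2.1).symm)
  · intro h1 h2
    rw [mem_crossEvent₁] at h1
    rw [mem_crossEvent₃] at h2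
    exact h2.2.2 h1.1
  · intro h1 h2
    rw [mem_crossEvent₁] at h1
    rw [mem_crossEvent₂] at h2
    exact h2.2.2 h1.1
  · intro h1 h2
    rw [mem_topEvent] at h1
    rw [mem_botEvent] at h2
    exact h2.1 h1.1

end MultiGraph

/-- **The polarised cross-term inequality** `M ≥ 0` of `C-005.md` §Induction, as a named Prop:
for every finite multigraph, every `p ∈ [0,1]^E`, every edge `e` and all vertices `a, b, c, d`,
`0 ≤ M(p, e)`. Verified on 37,223 census instances (n ≤ 6); the open T2 problem. -/
def CrossTermNonneg : Prop :=
  ∀ {V E : Type} [Fintype E] [DecidableEq E] (G : MultiGraph V E) (p : E → ℝ), IsProb p →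
    ∀ (e : E) (a b c d : V), 0 ≤ G.crossTerm p e a b c d

/-- **Reduction**: C-005 follows from `M ≥ 0` by induction on the free edges
(`D = t² D¹ + (1-t)² D⁰ + t(1-t) M`, base case `D = 0` at deterministic weights). -/
theorem C005conn_of_crossTermNonneg (hM : CrossTermNonneg) : C005conn := by
  intro V E _ _ G p hp a b c d
  suffices h : 0 ≤ G.c005Defect p a b c d by
    unfold MultiGraph.c005Defect at h
    linarith
  refine induction_free (P := fun q => 0 ≤ G.c005Defect q a b c d) ?_ ?_ hp
  · intro σ
    rw [G.c005Defect_detWeights]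
  · intro q e hq h1 h0
    rw [G.c005Defect_split q e a b c d]
    have ht := hq.nonneg e
    have ht' := hq.one_sub_nonneg e
    have hM' := hM G q hq e a b c d
    have := mul_nonneg (mul_nonneg ht ht') hM'
    nlinarith [sq_nonneg (q e), sq_nonneg (1 - q e), mul_nonneg (sq_nonneg (q e)) h1,
      mul_nonneg (sq_nonneg (1 - q e)) h0]

end PercRepro
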